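import Summits.Ventures.PercRepro.C026Recursion
import Summits.Ventures.PercRepro.C026SlackClosedForm

/-!
# Superadditivity of the C-026 slack: the reduction theorems and the `γ`-family (p6, gen 15)

Mine-3's CONJECTURE SA (`proofs/MINE3-SUPERADD.md`, ROW C-036 «SA¼» at the sharp constant `¼`) bounds
the pivotal product `I_D · I_A` of an edge `e` by a multiple of the C-026 slacks of the two minors
`p[e := 0]` (deletion) and `p[e := 1]` (contraction).  Over the tree's one-edge recursion `c026_rec`
(p5, `C026Recursion.lean`: `f(p) = p_e f(p[e:=1]) + (1 − p_e) f(p[e:=0]) − p_e (1 − p_e) I_D I_A`) this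
file proves the two REDUCTION THEOREMS of the note (§2, §14) as tree theorems:

* **`SAConst26 κ`** — SA with the constant `κ` at one edge: `I_D · I_A ≤ κ (f(p[e:=0]) + f(p[e:=1]))`;
  `SAQuarter26 = SAConst26 (1/4)` is ROW C-036 at `(G, p, e)`, and `Mix26` of the tree is `κ = 1`.
* **`slack26_nonneg_of_saConst_all`** — if SA with a constant `0 ≤ κ ≤ 1` holds at every edge for every
  weight vector, then C-026 holds at every weight vector (`C026At_of_saConst_all`,
  `C026At_of_saQuarter_all`, `C026At_of_mix_all`): induction on the **live** edges
  `{e : p_e ∉ {0, 1}}` (`fracEdges`), both minors having one live edge fewer; at a 0/1 weight vector the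
  law is a point mass (`prob_zeroOne_eq_zero_or_one`) and the slack is `≥ 0` by inspection.
* **The `γ`-family** (p6 INBOX 6716, mine-3 §14): `slackGamma γ = P(B ∧ Aᶜ) − γ·P(B)·P(Aᶜ)` in the five
  rows (`B = {c ↔ a} ∪ {c ↔ b}`, `A = {a ↔ b}`), its one-edge recursion
  `s_γ(p) = p_e s_γ(p[e:=1]) + (1 − p_e) s_γ(p[e:=0]) − γ p_e (1 − p_e) I_D I_A` (`slackGamma_rec`),
  and `slackGamma_nonneg_of_saGamma_all`: SA with the constant `κ` for `s_γ` at every edge closes the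
  induction exactly when `γ κ ≤ 1`.  The member `γ = ½` is C-026 (`slack26_eq_two_mul_slackGamma_half`);
  the member `γ = 2/3` is ROW C-035 in its five-row form (`c026Sharp_iff_rows` of the C-035 statement).

Nothing here proves SA or SA¼: these are the reductions, conditional on the row.
-/

namespace PercRepro

open Finset

/-! ### 0/1 weight vectors are point masses -/

section ZeroOne

variable {E : Type*} [Fintype E]

/-- A weight vector is **0/1** when every edge is surely closed or surely open. -/
def IsZeroOne (p : E → ℝ) : Prop := ∀ e, p e = 0 ∨ p e = 1

/-- The configuration a 0/1 weight vector charges: `e` open iff `p e = 1`. -/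
noncomputable def zeroOneConfig (p : E → ℝ) : Config E := fun e => decide (p e = 1)

/-- The charged configuration has weight `1`. -/
theorem weight_zeroOne_self {p : E → ℝ} (hp : IsZeroOne p) :
    weight p (zeroOneConfig p) = 1 := by
  unfold weight
  apply Finset.prod_eq_one
  intro e _
  rcases hp e with h | h
  · simp [zeroOneConfig, h]
  · simp [zeroOneConfig, h]

/-- Every other configuration has weight `0`. -/
theorem weight_zeroOne_of_ne {p : E → ℝ} (hp : IsZeroOne p) {ω : Config E}
    (hω : ω ≠ zeroOneConfig p) : weight p ω = 0 := by
  obtain ⟨e, he⟩ := Function.ne_iff.1 hω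
  unfold weight
  apply Finset.prod_eq_zero (Finset.mem_univ e)
  rcases hp e with h | h
  · cases hωe : ω e
    · exact absurd (by simp [zeroOneConfig, h, hωe]) he
    · simp [h]
  · cases hωe : ω e
    · simp [h]
    · exact absurd (by simp [zeroOneConfig, h, hωe]) he

/-- Under a 0/1 weight vector every event has probability `0` or `1`. -/
theorem prob_zeroOne_eq_zero_or_one [DecidableEq E] {p : E → ℝ} (hp : IsZeroOne p)
    (A : Set (Config E)) :
    prob p A = 0 ∨ prob p A = 1 := by
  have h : prob p A = A.indicator (weight p) (zeroOneConfig p) := by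
    unfold prob
    apply Finset.sum_eq_single
    · intro ω _ hω
      by_cases hA : ω ∈ A
      · rw [Set.indicator_of_mem hA, weight_zeroOne_of_ne hp hω]
      · rw [Set.indicator_of_notMem hA]
    · intro h
      exact absurd (Finset.mem_univ _) h
  rw [h]
  by_cases hA : zeroOneConfig p ∈ A
  · right
    rw [Set.indicator_of_mem hA, weight_zeroOne_self hp]
  · left
    rw [Set.indicator_of_notMem hA]

/-- The **fractional** (live) edges of a weight vector: those neither surely closed nor surely
open. -/
noncomputable def fracEdges (p : E → ℝ) : Finset E := univ.filter fun e => p e ≠ 0 ∧ p e ≠ 1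

/-- No fractional edge means a 0/1 weight vector. -/
theorem isZeroOne_of_fracEdges_eq_empty {p : E → ℝ} (h : fracEdges p = ∅) : IsZeroOne p := by
  intro e
  by_contra hne
  have : e ∈ fracEdges p := by
    simp only [fracEdges, Finset.mem_filter, Finset.mem_univ, true_and]
    exact ⟨fun h0 => hne (Or.inl h0), fun h1 => hne (Or.inr h1)⟩
  rw [h] at this
  exact Finset.notMem_empty e this

/-- Setting one edge to `0` or `1` removes it from the fractional edges and adds none. -/
theorem fracEdges_update_subset [DecidableEq E] (p : E → ℝ) (e : E) {x : ℝ}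
    (hx : x = 0 ∨ x = 1) :
    fracEdges (Function.update p e x) ⊆ (fracEdges p).erase e := by
  intro e' he'
  simp only [fracEdges, Finset.mem_filter, Finset.mem_univ, true_and] at he'
  by_cases h : e' = e
  · subst h
    rw [Function.update_self] at he'
    rcases hx with hx | hx <;> simp [hx] at he'
  · rw [Function.update_of_ne h] at he'
    simp [Finset.mem_erase, h, fracEdges, he']

/-- Fixing a fractional edge strictly decreases the number of fractional edges. -/
theorem card_fracEdges_update_lt [DecidableEq E] {p : E → ℝ} {e : E} (he : e ∈ fracEdges p) {x : ℝ}
    (hx : x = 0 ∨ x = 1) :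
    (fracEdges (Function.update p e x)).card < (fracEdges p).card :=
  lt_of_le_of_lt (Finset.card_le_card (fracEdges_update_subset p e hx))
    (Finset.card_erase_lt_of_mem he)

end ZeroOne

namespace MultiGraph

variable {V E : Type*} (G : MultiGraph V E) [Fintype E] [DecidableEq E]

/-! ### The base case: 0/1 weights -/

/-- Each row of `law3` is `0` or `1` under a 0/1 weight vector. -/
theorem law3_zeroOne {p : E → ℝ} (hp : IsZeroOne p) (a b c : V) (s : Fin 5) :
    G.law3 p a b c s = 0 ∨ G.law3 p a b c s = 1 :=
  prob_zeroOne_eq_zero_or_one hp _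

omit [Fintype E] [DecidableEq E] in
/-- Five 0/1 rows summing to `1`: the C-026 slack `(y₁ + y₂ + y₃) − (x + y₁)(y₁ + z)` is `≥ 0`. -/
theorem slack_rows_nonneg_of_zeroOne {x y₁ y₂ y₃ z : ℝ} (hx : x = 0 ∨ x = 1)
    (hy₁ : y₁ = 0 ∨ y₁ = 1) (hy₂ : y₂ = 0 ∨ y₂ = 1) (hy₃ : y₃ = 0 ∨ y₃ = 1) (hz : z = 0 ∨ z = 1)
    (hsum : x + y₁ + y₂ + y₃ + z = 1) :
    0 ≤ (y₁ + y₂ + y₃) - (x + y₁) * (y₁ + z) := by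
  rcases hx with hx | hx <;> rcases hy₁ with hy₁ | hy₁ <;> rcases hy₂ with hy₂ | hy₂ <;>
    rcases hy₃ with hy₃ | hy₃ <;> rcases hz with hz | hz <;> subst hx hy₁ hy₂ hy₃ hz <;>
    (norm_num at hsum <;> norm_num)

omit [Fintype E] [DecidableEq E] in
/-- Five 0/1 rows summing to `1`: the `γ`-slack `(y₂ + y₃) − γ (x + y₂ + y₃)(y₂ + y₃ + z)` is `≥ 0`
for `γ ≤ 1`. -/
theorem slackGamma_rows_nonneg_of_zeroOne {γ x y₁ y₂ y₃ z : ℝ} (hγ : γ ≤ 1) (hx : x = 0 ∨ x = 1)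
    (hy₁ : y₁ = 0 ∨ y₁ = 1) (hy₂ : y₂ = 0 ∨ y₂ = 1) (hy₃ : y₃ = 0 ∨ y₃ = 1) (hz : z = 0 ∨ z = 1)
    (hsum : x + y₁ + y₂ + y₃ + z = 1) :
    0 ≤ (y₂ + y₃) - γ * ((x + y₂ + y₃) * (y₂ + y₃ + z)) := by
  rcases hx with hx | hx <;> rcases hy₁ with hy₁ | hy₁ <;> rcases hy₂ with hy₂ | hy₂ <;>
    rcases hy₃ with hy₃ | hy₃ <;> rcases hz with hz | hz <;> subst hx hy₁ hy₂ hy₃ hz <;>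
    (norm_num at hsum <;> norm_num <;> linarith)

/-- C-026 at a 0/1 weight vector. -/
theorem slack26_nonneg_of_zeroOne {p : E → ℝ} (hp : IsZeroOne p) (a b c : V) :
    0 ≤ G.slack26 p a b c :=
  slack_rows_nonneg_of_zeroOne (G.law3_zeroOne hp a b c 0) (G.law3_zeroOne hp a b c 1)
    (G.law3_zeroOne hp a b c 2) (G.law3_zeroOne hp a b c 3) (G.law3_zeroOne hp a b c 4)
    (law3_sum_eq_one G p a b c)

/-! ### SA with a constant, and the reduction theorem -/

/-- **SA with the constant `κ` at the edge `e`** (mine-3's CONJECTURE SA, every `p`):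
`I_D · I_A ≤ κ · (f(p[e:=0]) + f(p[e:=1]))`.  `κ = 1` is the tree's `Mix26`. -/
def SAConst26 (κ : ℝ) (p : E → ℝ) (e : E) (a b c : V) : Prop :=
  G.pivD26 p e a b c * G.pivA26 p e a b c ≤
    κ * (G.slack26 (Function.update p e 0) a b c + G.slack26 (Function.update p e 1) a b c)

/-- **ROW C-036 «SA¼» at `(G, p, e)`** (mine-3, CONJECTURES v325): the sharp form
`I_D · I_A ≤ ¼ · (f(p[e:=0]) + f(p[e:=1]))`.  A conjecture: only its statement is typed here. -/
def SAQuarter26 (p : E → ℝ) (e : E) (a b c : V) : Prop :=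
  G.SAConst26 (1 / 4) p e a b c

/-- SA with a constant `κ ≤ 1` gives `(Mix)_e` once both minors satisfy C-026. -/
theorem Mix26_of_saConst26 {κ : ℝ} (hκ1 : κ ≤ 1) {p : E → ℝ} {e : E} {a b c : V}
    (h : G.SAConst26 κ p e a b c) (h0 : 0 ≤ G.slack26 (Function.update p e 0) a b c)
    (h1 : 0 ≤ G.slack26 (Function.update p e 1) a b c) : G.Mix26 p e a b c := by
  unfold SAConst26 at h
  unfold Mix26
  nlinarith [mul_le_mul_of_nonneg_right hκ1 (add_nonneg h0 h1)]

/-- **The reduction theorem** (MINE3-SUPERADD §2): SA with a constant `0 ≤ κ ≤ 1` at every edge of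
every weight vector gives C-026 at every weight vector.  Induction on the number of live edges:
at a live edge both minors have fewer, and `c026_of_mix` closes the step. -/
theorem slack26_nonneg_of_saConst_all {κ : ℝ} (hκ1 : κ ≤ 1) (a b c : V)
    (hSA : ∀ p : E → ℝ, IsProb p → ∀ e, G.SAConst26 κ p e a b c) :
    ∀ p : E → ℝ, IsProb p → 0 ≤ G.slack26 p a b c := by
  suffices H : ∀ n : ℕ, ∀ p : E → ℝ, IsProb p → (fracEdges p).card = n → 0 ≤ G.slack26 p a b c by
    intro p hp
    exact H _ p hp rfl
  intro n
  refine Nat.strong_induction_on n ?_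
  intro n ih p hp hn
  by_cases hlive : fracEdges p = ∅
  · exact G.slack26_nonneg_of_zeroOne (isZeroOne_of_fracEdges_eq_empty hlive) a b c
  · obtain ⟨e, he⟩ := Finset.nonempty_iff_ne_empty.2 hlive
    have h0 : 0 ≤ G.slack26 (Function.update p e 0) a b c :=
      ih _ (hn ▸ card_fracEdges_update_lt he (Or.inl rfl)) _
        (hp.update e ⟨le_rfl, zero_le_one⟩) rfl
    have h1 : 0 ≤ G.slack26 (Function.update p e 1) a b c :=
      ih _ (hn ▸ card_fracEdges_update_lt he (Or.inr rfl)) _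
        (hp.update e ⟨zero_le_one, le_rfl⟩) rfl
    exact G.c026_of_mix hp (G.Mix26_of_saConst26 hκ1 (hSA p hp e) h0 h1) h0 h1

/-- `(Mix)_e` at every edge of every weight vector gives C-026 everywhere (`κ = 1`). -/
theorem slack26_nonneg_of_mix_all (a b c : V)
    (hmix : ∀ p : E → ℝ, IsProb p → ∀ e, G.Mix26 p e a b c) :
    ∀ p : E → ℝ, IsProb p → 0 ≤ G.slack26 p a b c := by
  refine G.slack26_nonneg_of_saConst_all (κ := 1) le_rfl a b c ?_
  intro p hp e
  have h := hmix p hp e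
  unfold Mix26 at h
  unfold SAConst26
  linarith

/-- ROW C-036 at every edge of every weight vector gives C-026 everywhere (`κ = ¼`). -/
theorem slack26_nonneg_of_saQuarter_all (a b c : V)
    (hSA : ∀ p : E → ℝ, IsProb p → ∀ e, G.SAQuarter26 p e a b c) :
    ∀ p : E → ℝ, IsProb p → 0 ≤ G.slack26 p a b c :=
  G.slack26_nonneg_of_saConst_all (κ := 1 / 4) (by norm_num) a b c hSA

/-! ### The `γ`-family -/

/-- **The `γ`-slack** `s_γ = P(B ∧ Aᶜ) − γ·P(B)·P(Aᶜ)` in the five rows: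
`(y₂ + y₃) − γ (x + y₂ + y₃)(y₂ + y₃ + z)`.  `γ = ½` is half the C-026 slack, `γ = 2/3` is ROW C-035. -/
noncomputable def slackGamma (γ : ℝ) (p : E → ℝ) (a b c : V) : ℝ :=
  (G.law3 p a b c 2 + G.law3 p a b c 3) -
    γ * ((G.law3 p a b c 0 + G.law3 p a b c 2 + G.law3 p a b c 3) *
      (G.law3 p a b c 2 + G.law3 p a b c 3 + G.law3 p a b c 4))

/-- The `γ`-slack as probabilities: `P(B ∩ Aᶜ) − γ · P(B) · P(Aᶜ)`. -/
theorem slackGamma_eq_prob (γ : ℝ) (p : E → ℝ) (a b c : V) :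
    G.slackGamma γ p a b c =
      prob p ((G.connEvent c a ∪ G.connEvent c b) ∩ G.sepEvent a b) -
        γ * (prob p (G.connEvent c a ∪ G.connEvent c b) * prob p (G.sepEvent a b)) := by
  unfold slackGamma
  rw [G.law3_two_add_three_add_four p a b c, G.law3_zero_add_two_add_three p a b c,
    G.law3_two_add_three p a b c]

/-- The C-026 slack is twice the `γ = ½` member (`c026_slack_eq` on the simplex). -/
theorem slack26_eq_two_mul_slackGamma_half (p : E → ℝ) (a b c : V) :
    G.slack26 p a b c = 2 * G.slackGamma (1 / 2) p a b c := by
  have h := c026_slack_eq (law3_sum_eq_one G p a b c)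
  unfold slack26 slackGamma
  linear_combination h

/-- `I_D` in the rows of `B`: `P_{p[e:=1]}(B) − P_{p[e:=0]}(B)` (rows sum to `1` on both sides). -/
theorem pivD26_eq_rowsB (p : E → ℝ) (e : E) (a b c : V) :
    G.pivD26 p e a b c =
      (G.law3 (Function.update p e 1) a b c 0 + G.law3 (Function.update p e 1) a b c 2 +
          G.law3 (Function.update p e 1) a b c 3) -
        (G.law3 (Function.update p e 0) a b c 0 + G.law3 (Function.update p e 0) a b c 2 +
          G.law3 (Function.update p e 0) a b c 3) := by
  have h1 := law3_sum_eq_one G (Function.update p e 1) a b c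
  have h0 := law3_sum_eq_one G (Function.update p e 0) a b c
  unfold pivD26
  linarith

/-- `I_A` in the rows of `Aᶜ`: `P_{p[e:=0]}(Aᶜ) − P_{p[e:=1]}(Aᶜ)`. -/
theorem pivA26_eq_rowsAc (p : E → ℝ) (e : E) (a b c : V) :
    G.pivA26 p e a b c =
      (G.law3 (Function.update p e 0) a b c 2 + G.law3 (Function.update p e 0) a b c 3 +
          G.law3 (Function.update p e 0) a b c 4) -
        (G.law3 (Function.update p e 1) a b c 2 + G.law3 (Function.update p e 1) a b c 3 +
          G.law3 (Function.update p e 1) a b c 4) := by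
  have h1 := law3_sum_eq_one G (Function.update p e 1) a b c
  have h0 := law3_sum_eq_one G (Function.update p e 0) a b c
  unfold pivA26
  linarith

/-- **The one-edge recursion of the `γ`-family** (p6 INBOX 6716):
`s_γ(p) = p_e · s_γ(p[e:=1]) + (1 − p_e) · s_γ(p[e:=0]) − γ · p_e (1 − p_e) · I_D · I_A`. -/
theorem slackGamma_rec (γ : ℝ) (p : E → ℝ) (e : E) (a b c : V) :
    G.slackGamma γ p a b c =
      p e * G.slackGamma γ (Function.update p e 1) a b c +
        (1 - p e) * G.slackGamma γ (Function.update p e 0) a b c -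
        γ * (p e * (1 - p e)) * (G.pivD26 p e a b c * G.pivA26 p e a b c) := by
  have h : ∀ s, G.law3 p a b c s =
      p e * G.law3 (Function.update p e 1) a b c s +
        (1 - p e) * G.law3 (Function.update p e 0) a b c s :=
    fun s => prob_split p e _
  rw [G.pivD26_eq_rowsB, G.pivA26_eq_rowsAc]
  unfold slackGamma
  rw [h 0, h 2, h 3, h 4]
  ring

/-- **SA with the constant `κ` for the `γ`-slack at the edge `e`**:
`I_D · I_A ≤ κ · (s_γ(p[e:=0]) + s_γ(p[e:=1]))`. -/
def SAGamma26 (γ κ : ℝ) (p : E → ℝ) (e : E) (a b c : V) : Prop :=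
  G.pivD26 p e a b c * G.pivA26 p e a b c ≤
    κ * (G.slackGamma γ (Function.update p e 0) a b c + G.slackGamma γ (Function.update p e 1) a b c)

/-- **The one-step lemma of the family**: SA with the constant `κ` for `s_γ` at `e`, `γ κ ≤ 1`, and
`s_γ ≥ 0` on both minors give `s_γ ≥ 0` at `p`
(`s_γ ≥ (1 − p_e)(1 − γκ p_e) s_γ(p[e:=0]) + p_e (1 − γκ (1 − p_e)) s_γ(p[e:=1])`). -/
theorem slackGamma_nonneg_of_saGamma {γ κ : ℝ} (hγ0 : 0 ≤ γ) (hκ0 : 0 ≤ κ) (hγκ : γ * κ ≤ 1)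
    {p : E → ℝ} (hp : IsProb p) {e : E} {a b c : V} (hsa : G.SAGamma26 γ κ p e a b c)
    (h0 : 0 ≤ G.slackGamma γ (Function.update p e 0) a b c)
    (h1 : 0 ≤ G.slackGamma γ (Function.update p e 1) a b c) :
    0 ≤ G.slackGamma γ p a b c := by
  have hq := hp e
  have h1q : 0 ≤ 1 - p e := sub_nonneg.2 hq.2
  have hγκ0 : 0 ≤ γ * κ := mul_nonneg hγ0 hκ0
  have hA : 0 ≤ 1 - γ * κ * p e := by nlinarith
  have hB : 0 ≤ 1 - γ * κ * (1 - p e) := by nlinarith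
  rw [G.slackGamma_rec γ p e a b c]
  unfold SAGamma26 at hsa
  nlinarith [mul_le_mul_of_nonneg_left hsa (mul_nonneg hγ0 (mul_nonneg hq.1 h1q)),
    mul_nonneg (mul_nonneg h0 h1q) hA, mul_nonneg (mul_nonneg h1 hq.1) hB]

/-- The `γ`-slack at a 0/1 weight vector is `≥ 0` for `γ ≤ 1`. -/
theorem slackGamma_nonneg_of_zeroOne {γ : ℝ} (hγ : γ ≤ 1) {p : E → ℝ} (hp : IsZeroOne p)
    (a b c : V) : 0 ≤ G.slackGamma γ p a b c :=
  slackGamma_rows_nonneg_of_zeroOne hγ (G.law3_zeroOne hp a b c 0) (G.law3_zeroOne hp a b c 1)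
    (G.law3_zeroOne hp a b c 2) (G.law3_zeroOne hp a b c 3) (G.law3_zeroOne hp a b c 4)
    (law3_sum_eq_one G p a b c)

/-- **The reduction theorem of the `γ`-family** (mine-3 §14, p6 6716): for `0 ≤ γ ≤ 1` and
`0 ≤ κ` with `γ κ ≤ 1`, SA with the constant `κ` for `s_γ` at every edge of every weight vector
gives `s_γ ≥ 0` at every weight vector.  `γ = ½, κ = ½` is ROW C-036 ⟹ C-026; `γ = 2/3, κ = 3/4`
is the `2/3`-member of the family ⟹ ROW C-035 (its five-row form `2 P(B) P(Aᶜ) ≤ 3 P(B ∩ Aᶜ)`). -/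
theorem slackGamma_nonneg_of_saGamma_all {γ κ : ℝ} (hγ0 : 0 ≤ γ) (hγ1 : γ ≤ 1) (hκ0 : 0 ≤ κ)
    (hγκ : γ * κ ≤ 1) (a b c : V)
    (hSA : ∀ p : E → ℝ, IsProb p → ∀ e, G.SAGamma26 γ κ p e a b c) :
    ∀ p : E → ℝ, IsProb p → 0 ≤ G.slackGamma γ p a b c := by
  suffices H : ∀ n : ℕ, ∀ p : E → ℝ, IsProb p → (fracEdges p).card = n →
      0 ≤ G.slackGamma γ p a b c by
    intro p hp
    exact H _ p hp rfl
  intro n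
  refine Nat.strong_induction_on n ?_
  intro n ih p hp hn
  by_cases hlive : fracEdges p = ∅
  · exact G.slackGamma_nonneg_of_zeroOne hγ1 (isZeroOne_of_fracEdges_eq_empty hlive) a b c
  · obtain ⟨e, he⟩ := Finset.nonempty_iff_ne_empty.2 hlive
    have h0 : 0 ≤ G.slackGamma γ (Function.update p e 0) a b c :=
      ih _ (hn ▸ card_fracEdges_update_lt he (Or.inl rfl)) _
        (hp.update e ⟨le_rfl, zero_le_one⟩) rfl
    have h1 : 0 ≤ G.slackGamma γ (Function.update p e 1) a b c :=
      ih _ (hn ▸ card_fracEdges_update_lt he (Or.inr rfl)) _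
        (hp.update e ⟨zero_le_one, le_rfl⟩) rfl
    exact G.slackGamma_nonneg_of_saGamma hγ0 hκ0 hγκ hp (hSA p hp e) h0 h1

/-- SA¼ for the `2/3`-member `g = 3 s_{2/3}` (`I_D I_A ≤ ¼ (g(p[e:=0]) + g(p[e:=1]))`, p6 6716) at
every edge of every weight vector gives the `2/3`-slack `≥ 0` everywhere — ROW C-035 at every `p`
in its five-row form. -/
theorem slackGamma_twoThirds_nonneg_of_saQuarter_all (a b c : V)
    (hSA : ∀ p : E → ℝ, IsProb p → ∀ e, G.SAGamma26 (2 / 3) (3 / 4) p e a b c) :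
    ∀ p : E → ℝ, IsProb p → 0 ≤ G.slackGamma (2 / 3) p a b c :=
  G.slackGamma_nonneg_of_saGamma_all (by norm_num) (by norm_num) (by norm_num) (by norm_num) a b c hSA

end MultiGraph

/-! ### C-026 itself -/

namespace MultiGraph

variable {V E : Type} (G : MultiGraph V E) [Fintype E] [DecidableEq E]

/-- `C026At` is `0 ≤ slack26`. -/
theorem C026At_iff_slack26_nonneg (p : E → ℝ) (a b c : V) :
    G.C026At p a b c ↔ 0 ≤ G.slack26 p a b c := by
  unfold C026At slack26
  exact sub_nonneg.symm

/-- **C-026 from SA with any constant `κ ≤ 1`** at every edge of every weight vector. -/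
theorem C026At_of_saConst_all {κ : ℝ} (hκ1 : κ ≤ 1) (a b c : V)
    (hSA : ∀ p : E → ℝ, IsProb p → ∀ e, G.SAConst26 κ p e a b c) :
    ∀ p : E → ℝ, IsProb p → G.C026At p a b c := by
  intro p hp
  rw [G.C026At_iff_slack26_nonneg]
  exact G.slack26_nonneg_of_saConst_all hκ1 a b c hSA p hp

/-- **C-026 from `(Mix)_e` at every edge** of every weight vector (mine-3's SA, `κ = 1`). -/
theorem C026At_of_mix_all (a b c : V)
    (hmix : ∀ p : E → ℝ, IsProb p → ∀ e, G.Mix26 p e a b c) :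
    ∀ p : E → ℝ, IsProb p → G.C026At p a b c := by
  intro p hp
  rw [G.C026At_iff_slack26_nonneg]
  exact G.slack26_nonneg_of_mix_all a b c hmix p hp

/-- **ROW C-036 ⟹ ROW C-026**: SA¼ at every edge of every weight vector gives C-026 everywhere. -/
theorem C026At_of_saQuarter_all (a b c : V)
    (hSA : ∀ p : E → ℝ, IsProb p → ∀ e, G.SAQuarter26 p e a b c) :
    ∀ p : E → ℝ, IsProb p → G.C026At p a b c := by
  intro p hp
  rw [G.C026At_iff_slack26_nonneg]
  exact G.slack26_nonneg_of_saQuarter_all a b c hSA p hp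

end MultiGraph

end PercRepro
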